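import Summits.ResolutionOfSingularities.ResolutionOfSingularities.Theorems.EquisingularLiftEquisingularLiftNatTowerRuledDefs
import HarnessLib

/-!
# [OURS · L1 W4.5(b) · EL♮(3)] `DirLift.Ruled` AT ITS TWO KINDS OF BIRTH, in the binders of res-D-pv-029's stand-ins: the CURVE STEP
# (`Tower.inv₂_of_invKC_curveStep`, …NatTowerCurveStepCartier p558664) and a ROUND at a stage (`Tower.inv₂_coneRound_new` p558403 / the Čech round)

Crux chain w45b (cell `res-hironaka`, slot W4.5(b)), working crux **EL♮** = stmt-ResolutionOfSingularities-20038, child **EL♮(3)** =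
stmt-ResolutionOfSingularities-20148, route EquisingularLift, line `sections`; registered stubs `stub_elnat_coneTowerPointResolution` @ `ReachTower₂`
and `stub_elnat_ratDirZeroPointResolution` @ `ReachDirZero₁` (CHILD v19 4b326de54e94ad4b). Written by res-L1-w45b-stub-2 g7 after RULED-DEFS
(…NatTowerRuledDefs; res-L1-w45b-plan-1 NAMING 2026-08-27T19:11:35Z). HONEST FRAMING: OURS; NOT a statement of any manuscript; AI-written, weaker
than expert review. No `sorry`; standard axioms; DEF-FREE. `--supports stmt-ResolutionOfSingularities-20148 --as helper`.

WHAT. Two specialisations of `DirLift.ruled_root` whose binder lists are res-D-pv-029's `hRuled` stand-ins PLUS the inputs the stand-ins lack: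
* `DirLift.ruled_curveStep_root` — the curve step (root `X₀ := X` the stage over the carrier stage `F₉`, `I := 𝒞` the centre with reduced trace
  `𝒞·𝒪_{F₉} = 𝓘⟨Z₉⟩`, `G₀ := F₉`, `γ₀ := 𝟙`, `Z₀ := Z₉`, `δ₀ := 𝟙`): 029's shape `(X σ S jG tG) 𝒞 (X₁₀ τ j₁₀ t₁₀)` with `𝒞 := 𝓢 ⊔ K`, plus
  `IsBlowup υ' 𝓘⟨Z₉⟩` (in 029's context), the E1-legality `σ '' supp 𝒞 ⊆ {¬ generic pt of Y}` (029's (iv)), QUASI-REGULAR 2-FRAMES of `𝒞` at its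
  points (two local generators `(σ̃, κ)` forming a weakly regular sequence suffice: Literature `isQuasiRegular_of_isWeaklyRegular`), and the
  CONDITIONAL UPSTAIRS RATIONALITY `RationalCarrier Z̃₉ → Nonempty (V(𝒞) ≅ ℙ¹_O over O)` — the one genuinely new debt, owed only on rational towers;
  conclusion `DirLift.Ruled … F₁₀ (𝟙 F₁₀) (υ'⁻¹ Z₉) X₁₀ (τ ≫ σ) j₁₀ (𝒞.comap τ)` VERBATIM as the stand-in concludes.
* `DirLift.ruled_round_root` — a round at the stage `(G, γ)` / `(X, σ, jG, tG)` with centre `𝒞` (`𝒞·𝒪_G = 𝓘⟨Z⟩`; Čech round: `𝒞 :=` the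
  direction centre `controlledTransform τ₀ I 𝒟 1` of `directionRoundStep`, cone round: `𝒞 := 𝓔 ⊔ 𝒦`), the blow-up `τ : X'' ⟶ X` of `𝒞` with model
  square `(j₂, t₂)`, `j₂ ≫ τ = υ₂ ≫ jG`, `υ₂` the blow-up of `𝓘⟨Z⟩`, and the SECTION isomorphism `δ : Z̃ ≅ Z̃₉` over `γ ≫ υ'` (`DirStepSec`; for a
  cone round the centre isomorphism chain of res-D-pv-051 p547344), plus the same four inputs for `𝒞`; conclusion
  `DirLift.Ruled … G' (υ₂ ≫ γ) E' X'' (τ ≫ σ) j₂ (𝒞.comap τ)` for every `E'` (the stand-in has `E' = υ₂⁻¹ Z`).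

References (index only): res-D-pv-029 …NatTowerCurveStep(Cartier) p555599 / p558664, …NatTowerConeRound p558403, …NatTowerInvDefs p556392;
res-L1-w45b-stub-2 `directionRoundStep` p556868; res-D-pv-051 cone-round bricks p545368 / p547344 / p549332.
-/

set_option linter.dupNamespace false -- mandated namespace `Summit.<Summit>.<Problem>` of this single-conjunct summit

noncomputable section

open CategoryTheory CategoryTheory.Limits AlgebraicGeometry TopologicalSpace Topology IsLocalRing
open Literature.AlgebraicGeometry.Resolution
open Literature.AlgebraicGeometry.Morphisms (ProjCech.PP ProjCech.toSpec)
open AlgebraicGeometry.Scheme.IdealSheafData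

namespace Summit.ResolutionOfSingularities.ResolutionOfSingularities.Cruxes.EquisingularLiftNat.Sections.DirLift

variable {O : Type} [CommRing O] {k : Type} [Field k] {θ : O →+* k} {P : Scheme.{0}} {q : P ⟶ Spec (.of O)} {Y : Set P}

/-- **`DirLift.Ruled` is born at the CURVE STEP** (see the module docstring): res-D-pv-029's curve-step stand-in `hRuled`, with the inputs
it lacks made explicit — the carrier blow-up `υ'`, the E1-legality of the centre, quasi-regular 2-frames of the centre at its points, and the
conditional upstairs rationality of the centre. [OURS · pure logic over …NatTowerRuledDefs] toward `stub_elnat_coneTowerPointResolution` /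
`stub_elnat_ratDirZeroPointResolution`; NOT a statement of the manuscript. -/
theorem ruled_curveStep_root {F₉ : Scheme.{0}} {Z₉ : Set F₉} {hZ₉ : IsClosed Z₉} {F₁₀ : Scheme.{0}} {υ' : F₁₀ ⟶ F₉}
    (hυ' : IsBlowup υ' (vanishingIdeal ⟨Z₉, hZ₉⟩))
    (X : Scheme.{0}) (σ : X ⟶ P) (jG : F₉ ⟶ X) (tG : F₉ ⟶ Spec (.of k)) (𝒞 : X.IdealSheafData)
    (X₁₀ : Scheme.{0}) (τ : X₁₀ ⟶ X) (j₁₀ : F₁₀ ⟶ X₁₀) (t₁₀ : F₁₀ ⟶ Spec (.of k))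
    [IsIntegral X] [IsLocallyNoetherian X] (hXreg : Scheme.IsRegular X)
    (hsq : IsPullback jG tG (σ ≫ q) (Spec.map (CommRingCat.ofHom θ)))
    (hCD : 𝒞.comap jG = vanishingIdeal ⟨Z₉, hZ₉⟩) (hCflat : Flat (𝒞.subschemeι ≫ σ ≫ q)) (hCreg : Scheme.IsRegular 𝒞.subscheme)
    (hτ : IsBlowup τ 𝒞) (hsq₁₀ : IsPullback j₁₀ t₁₀ ((τ ≫ σ) ≫ q) (Spec.map (CommRingCat.ofHom θ))) (hcomm : j₁₀ ≫ τ = υ' ≫ jG)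
    -- the inputs the stand-in lacks
    (hCoff : σ '' (𝒞.support : Set X) ⊆ {p : P | ¬ IsGenericPoint p Y})
    (hCframe : ∀ x ∈ 𝒞.support, ∃ c : Fin 2 → X.presheaf.stalk x, Ideal.span (Set.range c) = stalkIdeal 𝒞 x ∧ IsQuasiRegular c)
    (hCrat : RationalCarrier (redSub F₉ Z₉ hZ₉) →
      ∃ e₁ : 𝒞.subscheme ≅ ProjCech.PP O 1, e₁.hom ≫ ProjCech.toSpec O 1 = 𝒞.subschemeι ≫ σ ≫ q) :
    Ruled O k θ P q Y F₉ Z₉ hZ₉ F₁₀ υ' F₁₀ (𝟙 F₁₀) (υ' ⁻¹' Z₉) X₁₀ (τ ≫ σ) j₁₀ (𝒞.comap τ) := by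
  have hυ₁ : IsBlowup υ' (𝒞.comap jG) := by rw [hCD]; exact hυ'
  haveI : IsIso (𝟙 (redSub F₉ Z₉ hZ₉)) := inferInstance
  exact ruled_root X σ 𝒞 X₁₀ τ F₉ jG tG (𝟙 F₉) F₁₀ j₁₀ t₁₀ υ' (𝟙 F₁₀) (υ' ⁻¹' Z₉) hXreg hτ hsq hsq₁₀ hcomm hυ₁
    (by simp only [Category.id_comp, Category.comp_id]) Z₉ hZ₉ hCD (𝟙 _) (by simp only [Category.id_comp, Category.comp_id])
    hCreg hCflat hCoff hCframe hCrat

/-- **`DirLift.Ruled` is born at a ROUND** (Čech round along a section, or cone round) at the stage `(G, γ)` / `(X, σ, jG, tG)` (see the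
module docstring): res-D-pv-029's round stand-in `hRuled` with the inputs it lacks made explicit — the downstairs blow-up `υ₂` of `𝓘⟨Z⟩`, the
SECTION isomorphism `δ : Z̃ ⟶ Z̃₉` over `γ ≫ υ'`, the E1-legality, quasi-regular 2-frames and conditional upstairs rationality of the centre.
[OURS · pure logic over …NatTowerRuledDefs] toward `stub_elnat_coneTowerPointResolution` / `stub_elnat_ratDirZeroPointResolution`; NOT a
statement of the manuscript. -/
theorem ruled_round_root {F₉ : Scheme.{0}} {Z₉ : Set F₉} {hZ₉ : IsClosed Z₉} {F₁₀ : Scheme.{0}} {υ' : F₁₀ ⟶ F₉}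
    {G G' : Scheme.{0}} (γ : G ⟶ F₁₀) (Z : Set G) (hZ : IsClosed Z) (υ₂ : G' ⟶ G) (hυ₂ : IsBlowup υ₂ (vanishingIdeal ⟨Z, hZ⟩))
    (δ : redSub G Z hZ ⟶ redSub F₉ Z₉ hZ₉) (hδ : δ ≫ redSubι F₉ Z₉ hZ₉ = redSubι G Z hZ ≫ γ ≫ υ') [IsIso δ]
    (X : Scheme.{0}) (σ : X ⟶ P) (jG : G ⟶ X) (tG : G ⟶ Spec (.of k)) (𝒞 : X.IdealSheafData)
    (X'' : Scheme.{0}) (τ : X'' ⟶ X) (j₂ : G' ⟶ X'') (t₂ : G' ⟶ Spec (.of k))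
    [IsIntegral X] [IsLocallyNoetherian X] (hXreg : Scheme.IsRegular X)
    (hsq : IsPullback jG tG (σ ≫ q) (Spec.map (CommRingCat.ofHom θ)))
    (hCZ : 𝒞.comap jG = vanishingIdeal ⟨Z, hZ⟩) (hCflat : Flat (𝒞.subschemeι ≫ σ ≫ q)) (hCreg : Scheme.IsRegular 𝒞.subscheme)
    (hτ : IsBlowup τ 𝒞) (hsq₂ : IsPullback j₂ t₂ ((τ ≫ σ) ≫ q) (Spec.map (CommRingCat.ofHom θ))) (hcomm : j₂ ≫ τ = υ₂ ≫ jG)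
    (hCoff : σ '' (𝒞.support : Set X) ⊆ {p : P | ¬ IsGenericPoint p Y})
    (hCframe : ∀ x ∈ 𝒞.support, ∃ c : Fin 2 → X.presheaf.stalk x, Ideal.span (Set.range c) = stalkIdeal 𝒞 x ∧ IsQuasiRegular c)
    (hCrat : RationalCarrier (redSub F₉ Z₉ hZ₉) →
      ∃ e₁ : 𝒞.subscheme ≅ ProjCech.PP O 1, e₁.hom ≫ ProjCech.toSpec O 1 = 𝒞.subschemeι ≫ σ ≫ q)
    (E' : Set G') :
    Ruled O k θ P q Y F₉ Z₉ hZ₉ F₁₀ υ' G' (υ₂ ≫ γ) E' X'' (τ ≫ σ) j₂ (𝒞.comap τ) := by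
  have hυ₁ : IsBlowup υ₂ (𝒞.comap jG) := by rw [hCZ]; exact hυ₂
  exact ruled_root X σ 𝒞 X'' τ G jG tG (γ ≫ υ') G' j₂ t₂ υ₂ (υ₂ ≫ γ) E' hXreg hτ hsq hsq₂ hcomm hυ₁
    (by simp only [Category.assoc]) Z hZ hCZ δ hδ hCreg hCflat hCoff hCframe hCrat

end Summit.ResolutionOfSingularities.ResolutionOfSingularities.Cruxes.EquisingularLiftNat.Sections.DirLift

end
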